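import Mathlib
import HarnessLib
import Summits.Langlands.Langlands.Statement
import Literature.NumberTheory.GaloisRepresentations.LocalGaloisGroupFrobeniusProofs
import Literature.NumberTheory.Automorphic.LocalConstantsProofs
import Literature.NumberTheory.Automorphic.LocalLanglandsGLProofs
import Literature.NumberTheory.Automorphic.ReciprocityGLnExistenceProofs
import Literature.NumberTheory.Automorphic.BaseChangeStrongCuspidalPrime
import Literature.RepresentationTheory.Semisimple.SubrepresentationEquiv

/-!
# Direction (A), CM ⇒ totally real: the WEAK (a.e. Satake) transfer by Sorensen patching — `R`-free core
# (crux `ReciprocityTRCM`, stmt-Langlands-1093, line `registered`; `--supports` helper for the registered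
# stub `stub_autToGalCMtoTR` = item stmt-Langlands-1063 `LiftDescend.AutToGalCMtoTR`)

Support file (closes nothing).  The stub asks for direction (A) over every totally real `F` in FULL form
(a datum `R : ReciprocityData F` to be PRODUCED; `Corresponds R ι π ρ` at EVERY finite place; pinned
geometricity) from (A) over every CM field — formally out of reach today (no transport of
`LocalLanglandsDatum` / `LocalGlobalCompatibleAt` / the pinned Fontaine datum along `F_v ≃+* E_w`; lead
memo).  Proved here is the Galois-side core of the printed argument (Sorensen 2020 Thm. 1 =
Harris–Lan–Taylor–Thorne, proof of Cor. 7.14 = Harris–Taylor, proof of Thm. VII.1.9), with NO reciprocity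
datum anywhere:
* `exists_rep_member_of_CM` — the representation of a member `F(√-D)` of the `∅`-general family
  `GoodPrime F m B` (CM, `GoodPrime.isCMField`): the strong base change `π_D` (hypothesis `hBC` = named fact
  `ArthurClozel1989_strongLifting_cuspidal`; L-algebraic by `harch` = `ArthurClozel1989_strongLifting_archimedean`)
  and the `R`-free CM input give `ρ_D` irreducible, `CompatibleAE` with the Frobenius datum of `π`
  (L-normalisation `arithFrobPolyOfSatake ι q_v 1 α_v`) and compatible with `π_v` above every completely
  split `v`;
* `exists_irreducible_satakeCompatible_of_CM` — the transfer, EVERY rank: patch by Sorensen's lemma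
  (`GoodPrime.exists_framedGaloisRep_of_compatibleAE`, PROVED), read off at split members
  (`GoodPrime.exists_split`), irreducibility from `r|_{Γ_{F(√-D)}} ≅ ρ_D`.
The stub's hypothesis VERBATIM feeds the `R`-free CM input through `Corresponds` and the landed converse
matching `ReciprocityUpToIrreducibility.satakeFrobCompatibleAt_of_localGlobalCompatibleAt_away` (`2 ≤ n`; a
15-line wrapper kept OUT of this file only because that theorem's import chain is farm-incoherent today).  Conditional exactly on the two UNDISCHARGED Arthur–Clozel named facts
(explicit hypotheses).  No definitions, no new named facts; standard axioms.

## References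
* C. M. Sorensen, *A patching lemma*, LMS Lecture Note Ser. 457 (2020), §1 Lemma 2, Thm. 1. [Sorensen2020]
* M. Harris, K.-W. Lan, R. Taylor, J. Thorne, Res. Math. Sci. 3:37 (2016), proof of Cor. 7.14 (p. 232).
  [HarrisLanTaylorThorneRMS2016]
* M. Harris, R. Taylor, Ann. of Math. Stud. 151 (2001), proof of Thm. VII.1.9 (pp. 229–232). [HarrisTaylorAMS2001]
* J. Arthur, L. Clozel, Ann. of Math. Stud. 120 (1989), Ch. 3, (1.1), Thm. 4.2 (a), Thm. 5.1. [ArthurClozelAMS120]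
* K. Buzzard, T. Gee, LMS Lecture Note Ser. 414 (2014), Conj. 3.2.1. [BuzzardGeeLMS2014]
-/

noncomputable section

set_option linter.dupNamespace false -- project-wide option; `Summit.Langlands.Langlands` is the mandated namespace

open scoped MatrixGroups Matrix NumberField Classical Polynomial
open Filter IsDedekindDomain Field NumberField Polynomial
open Literature.NumberTheory.Automorphic Literature.NumberTheory.GaloisRepresentations
open Literature.NumberTheory.GaloisRepresentations.QuadraticFamily
open Literature.NumberTheory.Automorphic.PatchingFamily
open Summit.Langlands

namespace Summit.Langlands.Langlands.Theorems.ReciprocityTRCM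

section Irreducible
variable {K : Type} [Field K] {k : Type*} [Field k] [TopologicalSpace k] [IsTopologicalRing k] {n : ℕ}

/-- An irreducible framed Galois representation over a field is semisimple. [folklore] -/
theorem isSemisimple_of_isIrreducible (ρ : FramedGaloisRep K k n) (h : ρ.toGaloisRep.IsIrreducible) :
    ρ.toGaloisRep.IsSemisimple := by
  -- adapted from `FramedRep.isSemisimple_of_isIrreducible` (TaylorComplexConjugationOddRank)
  haveI : Representation.IsIrreducible ρ.toGaloisRep.toRepresentation := h
  change ComplementedLattice _
  infer_instance

/-- Irreducibility passes along an isomorphism of the underlying continuous representations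
(`Representation.isIrreducible_of_equiv`). [folklore] -/
theorem isIrreducible_of_equiv {ρ ρ' : FramedGaloisRep K k n} (e : ContinuousRep.Equiv ρ.toGaloisRep ρ'.toGaloisRep)
    (h : ρ.toGaloisRep.IsIrreducible) : ρ'.toGaloisRep.IsIrreducible := by
  haveI : Representation.IsIrreducible ρ.toGaloisRep.toRepresentation := h
  exact Literature.RepresentationTheory.Semisimple.Representation.isIrreducible_of_equiv e.toRepEquiv

/-- **A representation whose restriction to `Γ_L` is irreducible is irreducible**: a `Γ_K`-stable
subspace is `Γ_L`-stable (through `absGaloisRestrict K L`). [folklore] -/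
theorem isIrreducible_of_isIrreducible_restrictField (ρ : FramedGaloisRep K k n) (L : Type*) [Field L]
    [Algebra K L] (h : (ρ.restrictField L).toGaloisRep.IsIrreducible) : ρ.toGaloisRep.IsIrreducible := by
  -- adapted from `Representation.IsIrreducible.of_comp` (BCDTModularity)
  haveI : Representation.IsIrreducible (ρ.restrictField L).toGaloisRep.toRepresentation := h
  let res : Subrepresentation ρ.toGaloisRep.toRepresentation →
      Subrepresentation (ρ.restrictField L).toGaloisRep.toRepresentation :=
    fun σ ↦ ⟨σ.toSubmodule, fun g v hv ↦ σ.apply_mem_toSubmodule (absGaloisRestrict K L g) hv⟩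
  have hres : Function.Injective res := fun σ τ hστ ↦ by
    have h' := congrArg Subrepresentation.toSubmodule hστ
    exact Subrepresentation.toSubmodule_injective h'
  have hbot : res ⊥ = ⊥ := Subrepresentation.toSubmodule_injective rfl
  have htop : res ⊤ = ⊤ := Subrepresentation.toSubmodule_injective rfl
  haveI : Nontrivial (Subrepresentation ρ.toGaloisRep.toRepresentation) := ⟨⟨⊥, ⊤, fun hbt ↦ by
    have h' := congrArg res hbt
    rw [hbot, htop] at h'
    exact bot_ne_top h'⟩⟩
  exact ⟨fun σ ↦ (IsSimpleOrder.eq_bot_or_eq_top (res σ)).imp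
    (fun h' ↦ hres (h'.trans hbot.symm)) (fun h' ↦ hres (h'.trans htop.symm))⟩

end Irreducible
section Datum
variable {n : ℕ} {K : Type} [Field K] [NumberField K] {hcpt : isCompact_glFiniteIntegralLevel n K}
  {ℓ : ℕ} [Fact ℓ.Prime]

/-- **The Frobenius datum of `π` in the L-normalisation** (no half-twist): multisets `E v ⊆ ℚ̄_ℓ` with
`∏_{a ∈ E v}(X - a) = arithFrobPolyOfSatake ι q_v 1 α` for every Satake parameter `α` of `π` at `v` (its
roots; the Satake parameter is unique, `hasSatakeParamAt_unique_holds`). [cite: BuzzardGeeLMS2014, Conj. 3.2.1] -/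
theorem exists_frobDatum_one (π : AutomorphicRepData (AutomorphyDatum.gl n K hcpt))
    (ι : PadicAlgCl ℓ ≃+* ℂ) :
    ∃ E : HeightOneSpectrum (𝓞 K) → Multiset (PadicAlgCl ℓ),
      ∀ (v : HeightOneSpectrum (𝓞 K)) (α : Multiset ℂ), π.HasSatakeParamAt v α →
        ((E v).map fun a ↦ X - C a).prod = arithFrobPolyOfSatake ι v.residueCard 1 α := by
  -- adapted from `HarrisLanTaylorThorne2016.exists_frobDatum` (ReciprocityGLnPatchingAssembly), `n ↦ 1`
  classical
  refine ⟨fun v ↦ if h : ∃ α : Multiset ℂ, π.HasSatakeParamAt v α then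
    (arithFrobPolyOfSatake ι v.residueCard 1 h.choose).roots else 0, fun v α hα ↦ ?_⟩
  have h : ∃ α : Multiset ℂ, π.HasSatakeParamAt v α := ⟨α, hα⟩
  dsimp only
  rw [dif_pos h]
  obtain rfl : α = h.choose := π.hasSatakeParamAt_unique_holds hα h.choose_spec
  rw [roots_arithFrobPolyOfSatake, arithFrobPolyOfSatake, Multiset.map_map]
  rfl

/-- The finite places containing a non-zero natural number form a finite set (`Ideal.finite_factors`). [folklore] -/
theorem finite_setOf_natCast_mem {q : ℕ} (hq : q ≠ 0) :
    {v : HeightOneSpectrum (𝓞 K) | ((q : ℕ) : 𝓞 K) ∈ v.asIdeal}.Finite := by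
  have hne : Ideal.span {((q : ℕ) : 𝓞 K)} ≠ ⊥ := by
    rw [Ne, Ideal.span_singleton_eq_bot]
    exact_mod_cast hq
  refine (Ideal.finite_factors hne).subset fun v hv ↦ ?_
  simp only [Set.mem_setOf_eq] at hv ⊢
  exact (Ideal.dvd_iff_le).mpr ((Ideal.span_singleton_le_iff_mem _).mpr hv)

end Datum
section Member
variable {n : ℕ} {F : Type} [Field F] [NumberField F] {hcpt : isCompact_glFiniteIntegralLevel n F}
  {ℓ : ℕ} [Fact ℓ.Prime] {ι : PadicAlgCl ℓ ≃+* ℂ}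

/-- **The representation of a member `F(√-D)`, from direction (A) over CM fields in `R`-free weak form**
(the rôle of Harris–Lan–Taylor–Thorne's Thm. 7.13 in their Cor. 7.14).  `F` totally real, `π` cuspidal
L-algebraic, `E` its Frobenius datum, `B ⊇` the primes below a place ramified over `ℤ` or a ramified place
of `π`, `D ∈ GoodPrime F m B`: the place `v₀ ∣ D` is ramified in `F(√-D)` (`not_isUnramifiedIn_sqrtNegField`)
and `π` is unramified there, so the strong cuspidal base change `π_D` exists (`hBC`) and is L-algebraic
(`harch`); `F(√-D)` is CM, so the CM input gives `ρ` irreducible, Satake compatible with `π_D` a.e. and at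
the unramified places away from `ℓ`.  Then (i) `CompatibleAE E ρ` (strong relation `t_{π_D,w} = t_{π,v}^f`,
uniqueness of Satake parameters, `q_w = q_v^f`, `arithFrobPolyOfSatake_pow`); (ii) above a COMPLETELY SPLIT
`v ∋ q`, `q ≠ ℓ` good: `ρ` is unramified with characteristic polynomial `arithFrobPolyOfSatake ι q_v 1 α_v`.
[cite: HarrisTaylorAMS2001, proof of Thm. VII.1.9 (pp. 229–231)]
[cite: ArthurClozelAMS120, Ch. 3 Thm. 4.2 (a) and Thm. 5.1] -/
theorem exists_rep_member_of_CM (hBC : ArthurClozel1989_strongLifting_cuspidal)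
    (harch : ArthurClozel1989_strongLifting_archimedean)
    (hA' : ∀ (E : Type) [Field E] [NumberField E], IsCMField E →
      ∀ (hE : isCompact_glFiniteIntegralLevel n E) (P : CuspidalAutomorphicRepData n E hE),
        P.1.IsLAlgebraic → ∃ ρ : FramedGaloisRep E (PadicAlgCl ℓ) n, ρ.toGaloisRep.IsIrreducible ∧
          (∀ᶠ w : HeightOneSpectrum (𝓞 E) in cofinite, SatakeFrobCompatibleAt ι P.1 ρ w) ∧
          ∀ w : HeightOneSpectrum (𝓞 E), ((ℓ : ℕ) : 𝓞 E) ∉ w.asIdeal → P.1.IsUnramifiedAt w →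
            SatakeFrobCompatibleAt ι P.1 ρ w)
    (hF : IsTotallyReal F) (π : CuspidalAutomorphicRepData n F hcpt) (hπ : π.1.IsLAlgebraic)
    (E : HeightOneSpectrum (𝓞 F) → Multiset (PadicAlgCl ℓ))
    (hE : ∀ (v : HeightOneSpectrum (𝓞 F)) (α : Multiset ℂ), π.1.HasSatakeParamAt v α →
      ((E v).map fun a ↦ X - C a).prod = arithFrobPolyOfSatake ι v.residueCard 1 α)
    {m : ℕ} {B : Set ℕ}
    (hB : ∀ D : ℕ, D.Prime → D ∉ B → ∀ v : HeightOneSpectrum (𝓞 F), ((D : ℕ) : 𝓞 F) ∈ v.asIdeal →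
      Algebra.IsUnramifiedAt ℤ v.asIdeal ∧ π.1.IsUnramifiedAt v)
    (i : GoodPrime F m B) :
    ∃ ρ : FramedGaloisRep (sqrtNegField F i.1) (PadicAlgCl ℓ) n, ρ.toGaloisRep.IsIrreducible ∧
      CompatibleAE E ρ ∧
      ∀ q : ℕ, q.Prime → q ≠ ℓ → π.1.IsUnramifiedAbove q →
        ∀ v : HeightOneSpectrum (𝓞 F), ((q : ℕ) : 𝓞 F) ∈ v.asIdeal →
          (v.asIdeal.primesOver (𝓞 (sqrtNegField F i.1))).ncard = 2 →
          ∀ w : HeightOneSpectrum (𝓞 (sqrtNegField F i.1)), w.asIdeal.under (𝓞 F) = v.asIdeal →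
            ∀ α : Multiset ℂ, π.1.HasSatakeParamAt v α →
              ρ.IsUnramifiedAt w ∧
                ρ.HasFrobCharpolyAt w (arithFrobPolyOfSatake ι v.residueCard 1 α) := by
  -- adapted from `HarrisLanTaylorThorne2016.exists_rep_member` (ReciprocityGLnExistenceProofs)
  classical
  have hℓ : ℓ.Prime := Fact.out
  have hD : i.1.Prime := i.2.1
  -- the member field `L = F(√-D)` and its level structure
  have hL : isCompact_glFiniteIntegralLevel n (sqrtNegField F i.1) :=
    isCompact_glFiniteIntegralLevel_holds n (sqrtNegField F i.1)
  have hl2 : (Module.finrank F (sqrtNegField F i.1)).Prime := i.finrank_prime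
  -- a ramified place above `D` at which `π` is unramified
  obtain ⟨v₀, hv₀⟩ := exists_heightOneSpectrum_natCast_mem F hD
  obtain ⟨hunrZ, hπv₀⟩ := hB i.1 hD i.2.2.2.1 v₀ hv₀
  have hram : ¬ Algebra.IsUnramifiedIn (𝓞 (sqrtNegField F i.1)) v₀.asIdeal :=
    not_isUnramifiedIn_sqrtNegField v₀ (intValuation_natCast_eq_of_isUnramifiedAt hD v₀ hv₀ hunrZ)
  -- the strong base change `P = π_D`, cuspidal and L-algebraic
  obtain ⟨P, hP⟩ := hBC n F (sqrtNegField F i.1) hl2 hcpt π ⟨v₀, hram, hπv₀⟩ hL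
  haveI hcyc : IsCyclic (sqrtNegField F i.1 ≃ₐ[F] sqrtNegField F i.1) :=
    isCyclic_of_prime_card (p := Module.finrank F (sqrtNegField F i.1)) (hp := ⟨hl2⟩)
      (IsGalois.card_aut_eq_finrank F (sqrtNegField F i.1))
  have hPL : P.1.IsLAlgebraic := harch.isLAlgebraic_baseChange hcyc hl2 hP.isWeakBaseChangeLiftAE hπ
  -- `L` is CM: the CM input
  have hCM : IsCMField (sqrtNegField F i.1) := i.isCMField (Or.inl hF)
  obtain ⟨ρ, hirr, hae, hpt⟩ := hA' (sqrtNegField F i.1) hCM hL P hPL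
  refine ⟨ρ, hirr, ?_, ?_⟩
  · -- (i) compatibility almost everywhere with the datum of `π`
    have hunrK : ∀ᶠ v : HeightOneSpectrum (𝓞 F) in cofinite,
        Algebra.IsUnramifiedIn (𝓞 (sqrtNegField F i.1)) v.asIdeal := by
      filter_upwards [(Literature.NumberTheory.GaloisRepresentations.finite_setOf_not_isUnramifiedIn F
        (sqrtNegField F i.1)).compl_mem_cofinite] with v hv
      simpa using hv
    have hπunr : ∀ᶠ v : HeightOneSpectrum (𝓞 F) in cofinite, π.1.IsUnramifiedAt v :=
      π.1.hasSatakeParamAt_cofinite_holds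
    show ∀ᶠ w : HeightOneSpectrum (𝓞 (sqrtNegField F i.1)) in cofinite, _
    filter_upwards [hae, eventually_under (E := sqrtNegField F i.1) hunrK,
      eventually_under (E := sqrtNegField F i.1) hπunr] with w hw hwunr hwπ
    obtain ⟨α, hα⟩ := hwπ (w.under (𝓞 F)) rfl
    have hβ := hP w (w.under (𝓞 F)) α rfl (hwunr _ rfl) hα
    obtain ⟨α', hα', hunr_w, hch⟩ := hw
    obtain rfl : α' = α.map (· ^ w.asIdeal.inertiaDeg (𝓞 F)) :=
      P.1.hasSatakeParamAt_unique_holds hα' hβ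
    refine ⟨hunr_w, ?_⟩
    rw [Literature.NumberTheory.GaloisRepresentations.residueCard_eq_residueCard_pow_inertiaDeg (v := w.under (𝓞 F)) (w := w)
      rfl, arithFrobPolyOfSatake_pow] at hch
    have hroots : E (w.under (𝓞 F)) =
        (arithFrobPolyOfSatake ι (w.under (𝓞 F)).residueCard 1 α).roots := by
      rw [← hE _ α hα, Polynomial.roots_multiset_prod_X_sub_C]
    rw [frobPoly_eq_prod_map_pow, hroots]
    exact hch
  · -- (ii) at the places over a good `q`, over a completely split `v`
    intro q hq hqℓ hπq v hqv hsplit w hwv α hα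
    have hsplit' : (v.asIdeal.primesOver (𝓞 (sqrtNegField F i.1))).ncard =
        Module.finrank F (sqrtNegField F i.1) := by
      rw [finrank_sqrtNegField]
      exact hsplit
    have hunr : Algebra.IsUnramifiedIn (𝓞 (sqrtNegField F i.1)) v.asIdeal :=
      isUnramifiedIn_of_ncard_eq_finrank v hsplit'
    have hf : w.asIdeal.inertiaDeg (𝓞 F) = 1 := inertiaDeg_eq_one_of_ncard_eq_finrank v hsplit' w hwv
    have hβ : P.1.HasSatakeParamAt w α := by
      have h := hP w v α hwv hunr hα
      rw [hf] at h
      simpa using h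
    have hqw : ((q : ℕ) : 𝓞 (sqrtNegField F i.1)) ∈ w.asIdeal := by
      rw [HarrisLanTaylorThorne2016.natCast_mem_iff_natCast_mem_under (K := F) w q]
      change ((q : ℕ) : 𝓞 F) ∈ w.asIdeal.under (𝓞 F)
      rw [hwv]
      exact hqv
    have hℓw : ((ℓ : ℕ) : 𝓞 (sqrtNegField F i.1)) ∉ w.asIdeal := fun h ↦
      hqℓ (natPrime_eq_of_natCast_mem hq hℓ hqw h)
    obtain ⟨α', hα', hunr_w, hch⟩ := hpt w hℓw ⟨α, hβ⟩
    obtain rfl : α' = α := P.1.hasSatakeParamAt_unique_holds hα' hβ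
    refine ⟨hunr_w, ?_⟩
    rwa [Literature.NumberTheory.GaloisRepresentations.residueCard_eq_residueCard_pow_inertiaDeg hwv, hf, pow_one] at hch

end Member
section Transfer
variable {n : ℕ} {ℓ : ℕ} [Fact ℓ.Prime] {ι : PadicAlgCl ℓ ≃+* ℂ}

/-- **Direction (A), CM ⇒ totally real, weak `R`-free form, every rank** (Sorensen 2020, Thm. 1;
Harris–Lan–Taylor–Thorne, proof of Cor. 7.14).  Grant Arthur–Clozel's strong cuspidal base change in prime
degree (`hBC`) and its archimedean clause (`harch`).  If over every CM field every L-algebraic cuspidal `P`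
on `GL_n` has an irreducible `ρ_P : Γ_E → GL_n(ℚ̄_ℓ)` Satake–Frobenius compatible with `P` a.e. and at every
unramified place away from `ℓ`, then over every totally real `F` every L-algebraic cuspidal `π` has an
IRREDUCIBLE `r : Γ_F → GL_n(ℚ̄_ℓ)` Satake–Frobenius compatible with `π` at every place over every rational
prime `q ≠ ℓ` above which `π` is unramified, in particular a.e.: patch the representations of the members
`F(√-D)`, `D ∈ GoodPrime F 1 B` (`exists_rep_member_of_CM`) by Sorensen's lemma and read off through a
member in which `v` splits completely (`GoodPrime.exists_framedGaloisRep_of_compatibleAE`,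
`GoodPrime.exists_split`); `r` is irreducible because `r|_{Γ_{F(√-D)}} ≅ ρ_D` is.
[cite: Sorensen2020, §1 Lemma 2 and Thm. 1] [cite: HarrisLanTaylorThorneRMS2016, proof of Cor. 7.14 (p. 232)]
[cite: HarrisTaylorAMS2001, proof of Thm. VII.1.9 (pp. 229–232)] -/
theorem exists_irreducible_satakeCompatible_of_CM (hBC : ArthurClozel1989_strongLifting_cuspidal)
    (harch : ArthurClozel1989_strongLifting_archimedean)
    (hA' : ∀ (E : Type) [Field E] [NumberField E], IsCMField E →
      ∀ (hE : isCompact_glFiniteIntegralLevel n E) (P : CuspidalAutomorphicRepData n E hE),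
        P.1.IsLAlgebraic → ∃ ρ : FramedGaloisRep E (PadicAlgCl ℓ) n, ρ.toGaloisRep.IsIrreducible ∧
          (∀ᶠ w : HeightOneSpectrum (𝓞 E) in cofinite, SatakeFrobCompatibleAt ι P.1 ρ w) ∧
          ∀ w : HeightOneSpectrum (𝓞 E), ((ℓ : ℕ) : 𝓞 E) ∉ w.asIdeal → P.1.IsUnramifiedAt w →
            SatakeFrobCompatibleAt ι P.1 ρ w)
    {F : Type} [Field F] [NumberField F] (hF : IsTotallyReal F)
    {hcpt : isCompact_glFiniteIntegralLevel n F} (π : CuspidalAutomorphicRepData n F hcpt)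
    (hπ : π.1.IsLAlgebraic) :
    ∃ r : FramedGaloisRep F (PadicAlgCl ℓ) n, r.toGaloisRep.IsIrreducible ∧
      (∀ q : ℕ, q.Prime → q ≠ ℓ → π.1.IsUnramifiedAbove q →
        ∀ v : HeightOneSpectrum (𝓞 F), ((q : ℕ) : 𝓞 F) ∈ v.asIdeal → SatakeFrobCompatibleAt ι π.1 r v) ∧
      ∀ᶠ v : HeightOneSpectrum (𝓞 F) in cofinite, SatakeFrobCompatibleAt ι π.1 r v := by
  -- adapted from `HarrisLanTaylorThorne2016.theoremA_existence_of_baseChange` (ReciprocityGLnExistenceProofs)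
  classical
  have hℓ : ℓ.Prime := Fact.out
  -- the finite set `B` of bad rational primes
  choose f hf using fun w : HeightOneSpectrum (𝓞 F) ↦ exists_natPrime_natCast_mem w
  have hR : {w : HeightOneSpectrum (𝓞 F) | ¬ Algebra.IsUnramifiedAt ℤ w.asIdeal}.Finite := by
    refine (Ideal.finite_factors (differentIdeal_ne_bot (A := ℤ) (B := 𝓞 F))).subset
      fun w hw ↦ ?_
    simp only [Set.mem_setOf_eq] at hw ⊢
    by_contra hdvd
    exact hw ((not_dvd_differentIdeal_iff (A := ℤ)).mp hdvd)
  have hcof : {w : HeightOneSpectrum (𝓞 F) | ¬ π.1.IsUnramifiedAt w}.Finite :=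
    π.1.hasSatakeParamAt_cofinite_holds
  set B : Set ℕ := f '' ({w | ¬ Algebra.IsUnramifiedAt ℤ w.asIdeal} ∪ {w | ¬ π.1.IsUnramifiedAt w})
    with hBdef
  have hBfin : B.Finite := (hR.union hcof).image f
  have hB : ∀ D : ℕ, D.Prime → D ∉ B → ∀ v : HeightOneSpectrum (𝓞 F),
      ((D : ℕ) : 𝓞 F) ∈ v.asIdeal → Algebra.IsUnramifiedAt ℤ v.asIdeal ∧ π.1.IsUnramifiedAt v := by
    intro D hD hDB v hv
    have hfv : f v = D := natPrime_eq_of_natCast_mem (hf v).1 hD (hf v).2 hv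
    by_contra h
    rw [not_and_or] at h
    exact hDB ⟨v, by simpa [Set.mem_union, Set.mem_setOf_eq] using h, hfv⟩
  have hm : (1 : ℕ) ≠ 0 := one_ne_zero
  -- the Frobenius datum of `π` and the representations of the members
  obtain ⟨E, hE⟩ := exists_frobDatum_one π.1 ι
  choose ρ hirr hρc hρT using fun i : GoodPrime F 1 B ↦
    exists_rep_member_of_CM hBC harch hA' hF π hπ E hE hB i
  have hss : ∀ i, (ρ i).toGaloisRep.IsSemisimple := fun i ↦ isSemisimple_of_isIrreducible _ (hirr i)
  -- patching, with read-off at the places over the good rational primes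
  set T : Set (HeightOneSpectrum (𝓞 F)) :=
    {v | ∃ q : ℕ, q.Prime ∧ q ≠ ℓ ∧ π.1.IsUnramifiedAbove q ∧ ((q : ℕ) : 𝓞 F) ∈ v.asIdeal} with hTdef
  obtain ⟨r, -, hr, hrT⟩ := GoodPrime.exists_framedGaloisRep_of_compatibleAE hm hBfin E ρ hss hρc T
    (fun v hv ↦ by
      obtain ⟨q, hq, hqℓ, hπq, hqv⟩ := hv
      obtain ⟨i, hsplit⟩ := GoodPrime.exists_split F 1 B hm hBfin v
      rw [finrank_sqrtNegField] at hsplit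
      obtain ⟨α, hα⟩ := hπq v hqv
      refine ⟨i, hsplit, fun w hwv ↦ ?_⟩
      rw [hE v α hα]
      exact hρT i q hq hqℓ hπq v hqv hsplit w hwv α hα)
  -- Satake–Frobenius compatibility at the places over the good primes
  have hsat : ∀ q : ℕ, q.Prime → q ≠ ℓ → π.1.IsUnramifiedAbove q →
      ∀ v : HeightOneSpectrum (𝓞 F), ((q : ℕ) : 𝓞 F) ∈ v.asIdeal → SatakeFrobCompatibleAt ι π.1 r v := by
    intro q hq hqℓ hπq v hqv
    obtain ⟨hunr, hch⟩ := hrT v ⟨q, hq, hqℓ, hπq, hqv⟩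
    obtain ⟨α, hα⟩ := hπq v hqv
    refine ⟨α, hα, hunr, ?_⟩
    rw [← hE v α hα]
    exact hch
  refine ⟨r, ?_, hsat, ?_⟩
  · -- irreducibility, from a member
    obtain ⟨i⟩ := GoodPrime.nonempty F 1 B hm hBfin
    obtain ⟨e⟩ := hr i
    exact isIrreducible_of_isIrreducible_restrictField r (sqrtNegField F i.1)
      (isIrreducible_of_equiv e.symm (hirr i))
  · -- almost everywhere: the bad places lie over `ℓ` or over the finitely many bad rational primes
    have h1 : ∀ᶠ q : ℕ in cofinite, q.Prime → π.1.IsUnramifiedAbove q :=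
      π.1.isUnramifiedAbove_cofinite hcof
    rw [Filter.eventually_cofinite] at h1 ⊢
    have hfin : (⋃ q ∈ {q : ℕ | ¬ (q.Prime → π.1.IsUnramifiedAbove q)} ∪ {ℓ},
        {v : HeightOneSpectrum (𝓞 F) | ((q : ℕ) : 𝓞 F) ∈ v.asIdeal}).Finite := by
      refine (h1.union (Set.finite_singleton ℓ)).biUnion fun q hq ↦ finite_setOf_natCast_mem ?_
      rcases hq with hq | hq
      · simp only [Set.mem_setOf_eq, Classical.not_imp] at hq
        exact hq.1.ne_zero
      · rw [Set.mem_singleton_iff.mp hq]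
        exact hℓ.ne_zero
    refine hfin.subset fun v hv ↦ ?_
    simp only [Set.mem_setOf_eq] at hv
    simp only [Set.mem_iUnion, Set.mem_union, Set.mem_setOf_eq, Set.mem_singleton_iff, exists_prop]
    by_cases hfl : f v = ℓ
    · exact ⟨ℓ, Or.inr rfl, hfl ▸ (hf v).2⟩
    · refine ⟨f v, Or.inl ?_, (hf v).2⟩
      intro h
      exact hv (hsat (f v) (hf v).1 hfl (h (hf v).1) v (hf v).2)

end Transfer

section Registered

/-- **Registered form (`--supports` stub `autToGal_weak_totallyReal_of_CM` of crux stmt-Langlands-1093): direction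
(A), CM ⇒ totally real, WEAK `R`-free form, every rank** — `exists_irreducible_satakeCompatible_of_CM` closed over
all its parameters: granted Arthur–Clozel's strong cuspidal base change in prime degree and its archimedean clause
(the named facts `ArthurClozel1989_strongLifting_cuspidal`, `ArthurClozel1989_strongLifting_archimedean`, UNDISCHARGED,
as hypotheses), the `R`-free CM input (irreducible `ρ_P`, Satake–Frobenius compatible with `P` a.e. and at the
unramified places away from `ℓ`, for every L-algebraic cuspidal `P` over every CM field) yields over every totally
real `F`, for every L-algebraic cuspidal `π`, an irreducible `r` Satake–Frobenius compatible with `π` at every place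
over a good rational prime and almost everywhere (Sorensen patching over the family `F(√-D)`).
[cite: Sorensen2020, §1 Lemma 2 and Thm. 1] [cite: HarrisLanTaylorThorneRMS2016, proof of Cor. 7.14 (p. 232)] -/
theorem autToGal_weak_totallyReal_of_CM : Literature.NumberTheory.Automorphic.ArthurClozel1989_strongLifting_cuspidal → Literature.NumberTheory.Automorphic.ArthurClozel1989_strongLifting_archimedean → ∀ (n ℓ : ℕ) [Fact ℓ.Prime] (ι : PadicAlgCl ℓ ≃+* ℂ), (∀ (E : Type) [Field E] [NumberField E], NumberField.IsCMField E → ∀ (hE : Literature.NumberTheory.Automorphic.isCompact_glFiniteIntegralLevel n E) (P : Literature.NumberTheory.Automorphic.CuspidalAutomorphicRepData n E hE), P.1.IsLAlgebraic → ∃ ρ : Literature.NumberTheory.GaloisRepresentations.FramedGaloisRep E (PadicAlgCl ℓ) n, ρ.toGaloisRep.IsIrreducible ∧ (∀ᶠ w : IsDedekindDomain.HeightOneSpectrum (NumberField.RingOfIntegers E) in cofinite, SatakeFrobCompatibleAt ι P.1 ρ w) ∧ ∀ w : IsDedekindDomain.HeightOneSpectrum (NumberField.RingOfIntegers E), ((ℓ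 : ℕ) : NumberField.RingOfIntegers E) ∉ w.asIdeal → P.1.IsUnramifiedAt w → SatakeFrobCompatibleAt ι P.1 ρ w) → ∀ (F : Type) [Field F] [NumberField F], NumberField.IsTotallyReal F → ∀ (hcpt : Literature.NumberTheory.Automorphic.isCompact_glFiniteIntegralLevel n F) (π : Literature.NumberTheory.Automorphic.CuspidalAutomorphicRepData n F hcpt), π.1.IsLAlgebraic → ∃ r : Literature.NumberTheory.GaloisRepresentations.FramedGaloisRep F (PadicAlgCl ℓ) n, r.toGaloisRep.IsIrreducible ∧ (∀ q : ℕ, q.Prime → q ≠ ℓ → π.1.IsUnramifiedAbove q → ∀ v : IsDedekindDomain.HeightOneSpectrum (NumberField.RingOfIntegers F), ((q : ℕ) : NumberField.RingOfIntegers F) ∈ v.asIdeal → SatakeFrobCompatibleAt ι π.1 r v) ∧ ∀ᶠ v : IsDedekindDomain.HeightOneSpectrum (NumberField.RingOfIntegers F) in cofinite, SatakeFrobCompatibleAt ι π.1 r v :=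
  fun hBC harch _ _ _ _ hA' _ _ _ hF _ π hπ ↦ exists_irreducible_satakeCompatible_of_CM hBC harch hA' hF π hπ

end Registered
end Summit.Langlands.Langlands.Theorems.ReciprocityTRCM

end
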